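import Literature.AlgebraicGeometry.Resolution.AffineDomainDimension
import HarnessLib

/-!
# Dimension of the image of a polynomial map from algebraically independent coordinates

For a field `k`, a `k`-algebra domain `B` and a `k`-algebra map `φ : k[Y_1, …, Y_m] → B`, the
closed image `V(ker φ)` has Krull dimension `dim k[Y]/ker φ = trdeg_k (im φ)` (Matsumura,
*Commutative Ring Theory*, Thm. 5.6: the dimension of an affine domain is its transcendence
degree). Hence **if `e` of the values `φ(g_1), …, φ(g_e)` are algebraically independent over `k`,
then `dim k[Y]/ker φ ≥ e`.** This is the form in which a lower bound for the dimension of an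
irreducible subvariety given by a parametrisation (e.g. an orbit closure `t ↦ t · y₀`, `B` a
Laurent polynomial ring or a function field) is certified.

* `le_ringKrullDim_quotient_ker_of_algebraicIndependent` — the statement above.

Motivation: the dimension hypothesis `dim A/P ≥ e` of the Jacobian criterion
`Literature.RingTheory.MvPolynomial.map_eq_map_of_jacobian` with `P = ker φ`.

## References
* H. Matsumura, *Commutative Ring Theory*, CUP 1986, Thm. 5.6. [Matsumura1987]
-/

noncomputable section

namespace Literature.RingTheory.MvPolynomial

universe u

/-- **`dim k[Y]/ker φ ≥ e` if `e` values of `φ` are algebraically independent.** For a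
`k`-algebra map `φ : k[Y_1, …, Y_m] → B` into a domain and `g_1, …, g_e ∈ k[Y]` with
`φ(g_1), …, φ(g_e)` algebraically independent over `k`: the affine domain `k[Y]/ker φ` embeds in
`B`, contains the algebraically independent classes of the `g_i`, so has transcendence degree,
hence Krull dimension, at least `e`. [cite: Matsumura1987, Thm. 5.6] -/
theorem le_ringKrullDim_quotient_ker_of_algebraicIndependent {k : Type u} [Field k] {m e : ℕ}
    {B : Type u} [CommRing B] [IsDomain B] [Algebra k B]
    (φ : MvPolynomial (Fin m) k →ₐ[k] B) (g : Fin e → MvPolynomial (Fin m) k)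
    (hg : AlgebraicIndependent k (fun i => φ (g i))) :
    (e : WithBot ℕ∞) ≤ ringKrullDim (MvPolynomial (Fin m) k ⧸ RingHom.ker φ) := by
  haveI : (RingHom.ker φ).IsPrime := RingHom.ker_isPrime _
  obtain ⟨n, hdim, htr⟩ := Literature.AlgebraicGeometry.Resolution.exists_ringKrullDim_eq_and_trdeg_eq
    k (MvPolynomial (Fin m) k ⧸ RingHom.ker φ)
  -- the classes of the `g_i` are algebraically independent in `k[Y]/ker φ`
  have hg' : AlgebraicIndependent k (fun i => Ideal.Quotient.mk (RingHom.ker φ) (g i)) := by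
    refine AlgebraicIndependent.of_comp (Ideal.kerLiftAlg φ) ?_
    have h : (⇑(Ideal.kerLiftAlg φ) ∘ fun i => Ideal.Quotient.mk (RingHom.ker φ) (g i)) =
        fun i => φ (g i) := funext fun i => Ideal.kerLiftAlg_mk φ (g i)
    rw [h]
    exact hg
  have hle := hg'.lift_cardinalMk_le_trdeg
  rw [htr, Cardinal.mk_fin, Cardinal.lift_natCast, Cardinal.lift_natCast, Nat.cast_le] at hle
  rw [hdim]
  exact_mod_cast hle

end Literature.RingTheory.MvPolynomial

end
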